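import Summits.ABC.IUTFork.BrobergPoint
import Summits.ABC.ABC.Theorems.IUTThetaPilotThetaPartIIStubThetaData
import HarnessLib

/-!
# Broberg's point over `ℚ(√7)`: the place over `2`, ALL bad places, `U_P`-membership, `AdmitsCore`, (P2), (P5), and NON-VACUITY of the datum type modulo (P6)

PROOF-ONLY file (0 definitions, 0 `Prop` facts, no instance, no notation) of the abc-iut cell (D-0079 RESCUE sub-cell R-W, W1 ROW
DECISIONS seat abc-iut-W-row-2, gen 4); classical algebraic number theory of `ℚ(√7)` plus ONE application of the route's PROVED
`ThetaPartII.stub_thetaData`; TAKES NO SIDE on [IUTchIII] Cor. 3.12 or on any author. Rows «pilotDataOfK:broberg-Q7:7 / :11» of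
HOME/plan/rescue/R-W/OPEN-10.md (rows 9/10) are DECIDED-INHABITED on the ledger by theorems quantifying over
`T : Cor22.ThetaVolumeDatumAt Broberg.point l` (`WRow.licence_broberg_seven_unconditional` / `…_eleven_…`); this file supplies, for the
Broberg point `P = (ℚ(√7), λ)`, `λ = (8−3√7)²(5−2√7)/(4−3√7)⁴` (`Broberg.point`, `Broberg.lam` of `BrobergPoint.lean`), the ADMISSIBILITY
inputs of [IUTchIV] Cor. 2.2 (ii) proof (P7) exactly as `FreyAdm.*` (`FreyLegendreAdmissibleList.lean`) does for the rational rows: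
* §1 the prime over `2`: `2 = ε'·ϖ₂²` (`eps'_mul_ϖ₂_sq`), so `𝔭₂ = (3+√7)` is THE place containing `2` (`eq_of_two_mem`; `2` RAMIFIES,
  `log 𝔭₂(2) = −2`), and **`ord_{𝔭₂} j(λ) = 10`** (`ord_jInv_𝔭₂`) — hence `0 ≤ ord_v j(λ)` at EVERY place `v ∉ {𝔭₃, 𝔭₃', 𝔭₄₇}` with no
  «`v ∌ 2`» proviso (`ord_jInv_nonneg'`) and **`v ∈ badPlaces Broberg.point ↔ v ∈ {𝔭₃, 𝔭₃', 𝔭₄₇}`** (`mem_badPlaces_iff`);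
* §2 **`Broberg.point ∈ U_P`** (`point_mem_UP`): `λ ∉ {0, 1}` and `ℚ(λ) = ℚ(√7)` (`point_isMinimal`: `λ ∉ ℚ`, read off
  `λ·(10273 − 3792√7) = 1307 − 494√7`); `point_degree : [F_tpd : ℚ] = 2`;
* §3 **`Cor22.AdmitsCore Broberg.point`** (`admitsCore`): `ord_{𝔭₃} j(λ) = −2`, whereas the four core-exceptional rationals
  `2¹⁴31³/5³, 2²73³/3⁴, 2⁶3³, 0` have `ord_{𝔭₃} ∈ {0, −4, 3, 0}`;
* §4 **(P2)** `condP2 : l.Prime → 5 ≤ l → Cor22.CondP2 Broberg.point l` (the pole orders are `2, 24, 8`) and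
  **(P5)** `condP5 : l.Prime → Cor22.CondP5 Broberg.point l` (the pole `𝔭₃`, resp. `𝔭₄₇` when `l = 3`, divides neither `2` nor `l`);
* §5 **NON-VACUITY MODULO (P6)**: `nonempty_thetaVolumeDatumAt_of_condP6 : l.Prime → 5 ≤ l → Cor22.CondP6 Broberg.point l →
  Nonempty (Cor22.ThetaVolumeDatumAt Broberg.point l)` (= `ThetaPartII.stub_thetaData` fed with §2–§4), and its instances at the two
  tabulated levels `l = 7, 11`.
HONEST SCOPE: (P6) at the Broberg datum (the image of `Gal(ℚ̄/F)` on `E_λ[l]` containing `SL₂(𝔽_l)`) is NOT proved here and NOT claimed —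
the tree's Frobenius-certificate engine (`FreyP6Engine`, Mazur's isogeny-character criterion) is typed over `ℚ` only; «inhabited datum
type modulo (P6)» says our TYPED `ThetaVolumeDatumAt` has an element at `(Broberg.point, l)` once (P6) is supplied; Szpiro-badness and
the truth of any S_H are not touched; inhabited-as-typed ≠ true-in-print; typed ≠ proved; no abc claim.
[cite: Mochizuki2012, IUTchIV Cor. 2.2 (ii) proof (P2)(P5)(P7) p. 45–46, p. 43 (core)] [cite: MochizukiGenEll2010, Def. 1.5 (i) p. 8, Ex. 1.3 (i) p. 5]
[cite: NeukirchANT1999, Ch. I §8] [claim: Mochizuki2012, status: disputed] for every IUT sentence quoted.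
-/

noncomputable section

open scoped Classical NumberField

open NumberField IsDedekindDomain IsDedekindDomain.HeightOneSpectrum QuadraticAlgebra Module

namespace Summit.ABC.IUTFork.Broberg

open Sqrt7 Literature.IUT.LogVolume Literature.IUT.LogVolume.Cor22 Literature.NumberTheory.NumberFields
  Literature.NumberTheory.DiophantineGeometry.GenEll Summit.ABC.ABC.Theorems

/-! ### §1 The prime over `2` and the order of `j(λ)` there -/

/-- `2 = ε'·ϖ₂²` in `𝓞 ℚ(√7)` (`(8−3√7)(3+√7)² = 2`): `2` ramifies, `(2) = 𝔭₂²`. [cite: NeukirchANT1999, Ch. I §8] -/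
theorem eps'_mul_ϖ₂_sq : eps' * ϖ₂ ^ 2 = 2 := by
  unfold eps' ϖ₂; linear_combination (-3 * sqrt7Int - 10 : 𝓞 K) * sqrt7Int_sq

/-- **The only prime of `𝓞 ℚ(√7)` containing `2` is `𝔭₂ = (3 + √7)`.** [cite: NeukirchANT1999, Ch. I §8] -/
theorem eq_of_two_mem (v : HeightOneSpectrum (𝓞 K)) (h2 : (2 : 𝓞 K) ∈ v.asIdeal) : v = 𝔭₂ := by
  rw [← eps'_mul_ϖ₂_sq] at h2
  rcases v.isPrime.mem_or_mem h2 with h | h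
  · exact absurd (Ideal.eq_top_of_isUnit_mem _ h isUnit_eps') v.isPrime.ne_top
  · exact HeightOneSpectrum.ext
      (span_ϖ₂_isMaximal.eq_of_le v.isPrime.ne_top ((Ideal.span_singleton_le_iff_mem _).mpr (v.isPrime.mem_of_pow_mem 2 h))).symm

/-- **`log v(2) = −2·[v = 𝔭₂]`**: `2` is ramified at `𝔭₂` (`e = 2`) and a unit elsewhere. [cite: NeukirchANT1999, Ch. I §8] -/
theorem log_valuation_two (v : HeightOneSpectrum (𝓞 K)) :
    WithZero.log (v.valuation K (2 : K)) = if v = 𝔭₂ then -2 else 0 := by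
  have h2 : (2 : K) = ((eps' : 𝓞 K) : K) * ((ϖ₂ : 𝓞 K) : K) ^ 2 := by
    rw [← map_pow, ← map_mul, eps'_mul_ϖ₂_sq]; simp [map_ofNat]
  rw [h2, map_mul, map_pow, WithZero.log_mul (valuation_ne_zero_of_ne_zero v coe_ne_zero.2.2.2.2.2.2)
    (pow_ne_zero 2 (valuation_ne_zero_of_ne_zero v coe_ne_zero.2.2.2.2.1)), WithZero.log_pow, log_valuation_eps', log_valuation_ϖ₂]
  split_ifs <;> simp

/-- **`ord_{𝔭₂} j(λ) = 10`** (`λ ≡ 1 mod 𝔭₂³`: `v(λ) = 1`, `v(λ−1) = p⁻³`, numerator a unit, `v(2⁸) = p⁻¹⁶`; `−16 + 6 = −10`).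
[cite: Mochizuki2012, IUTchIV Cor. 2.2 (i) p.41] -/
theorem ord_jInv_𝔭₂ : ord K 𝔭₂ (jInv lam) = 10 := by
  have hl : WithZero.log (𝔭₂.valuation K lam) = 0 := by
    rw [log_valuation_lam, if_neg 𝔭₄₇_ne.2.2.1, if_neg 𝔭₄₇_ne.2.2.2.2]; norm_num
  have hs : WithZero.log (𝔭₂.valuation K (lam - 1)) = -3 := by
    rw [log_valuation_lam_sub_one, if_pos rfl, if_neg 𝔭₄₇_ne.2.2.2.1, if_neg 𝔭₄₇_ne.2.2.2.2]; norm_num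
  have hlt : 𝔭₂.valuation K (lam - 1) < 1 := lt_one_of_log_neg 𝔭₂ lam_sub_one_ne_zero (by rw [hs]; norm_num)
  have hnum : 𝔭₂.valuation K (lam ^ 2 - lam + 1) = 1 := valuation_numerator_of_sub_one_lt_one _ hlt
  have h2 : WithZero.log (𝔭₂.valuation K (2 : K)) = -2 := by rw [log_valuation_two, if_pos rfl]
  have h20 : 𝔭₂.valuation K (2 : K) ≠ 0 := valuation_ne_zero_of_ne_zero 𝔭₂ two_ne_zero
  unfold ord
  rw [valuation_jInv, log_jInv_shape h20 (by rw [hnum]; exact one_ne_zero)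
    (valuation_ne_zero_of_ne_zero 𝔭₂ lam_ne_zero) (valuation_ne_zero_of_ne_zero 𝔭₂ lam_sub_one_ne_zero), h2, hnum,
    WithZero.log_one, hl, hs]
  norm_num

/-- **`0 ≤ ord_v j(λ)` at EVERY finite place `v ∉ {𝔭₃, 𝔭₃', 𝔭₄₇}`** (no «`v ∌ 2`» proviso: at `𝔭₂` the order is `10`).
[cite: Mochizuki2012, IUTchIV Cor. 2.2 (i) p.41] -/
theorem ord_jInv_nonneg' {v : HeightOneSpectrum (𝓞 K)} (h3 : v ≠ 𝔭₃) (h3' : v ≠ 𝔭₃') (h47 : v ≠ 𝔭₄₇) :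
    0 ≤ ord K v (jInv lam) := by
  by_cases h2 : (2 : 𝓞 K) ∈ v.asIdeal
  · rw [eq_of_two_mem v h2, ord_jInv_𝔭₂]; norm_num
  · exact ord_jInv_nonneg h2 h3 h3' h47

/-- **The order of `j(λ)` is negative exactly at `𝔭₃, 𝔭₃', 𝔭₄₇`.** [cite: Mochizuki2012, IUTchIV Cor. 2.2 (i) p.41] -/
theorem ord_jInv_neg_iff (v : HeightOneSpectrum (𝓞 K)) : ord K v (jInv lam) < 0 ↔ v = 𝔭₃ ∨ v = 𝔭₃' ∨ v = 𝔭₄₇ := by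
  constructor
  · intro hv
    by_contra h
    push Not at h
    exact absurd hv (not_lt.mpr (ord_jInv_nonneg' h.1 h.2.1 h.2.2))
  · rintro (rfl | rfl | rfl)
    · rw [ord_jInv_𝔭₃]; norm_num
    · rw [ord_jInv_𝔭₃']; norm_num
    · rw [ord_jInv_𝔭₄₇]; norm_num

/-- **The bad places of Broberg's point are exactly `𝔭₃, 𝔭₃', 𝔭₄₇`** (poles of `j(λ)`; nothing over `2`).
[cite: Mochizuki2012, IUTchIV Cor. 2.2 (i) p.41] -/
theorem mem_badPlaces_iff (v : HeightOneSpectrum (𝓞 point.F)) : v ∈ badPlaces point ↔ v = 𝔭₃ ∨ v = 𝔭₃' ∨ v = 𝔭₄₇ :=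
  (mem_badPlaces_iff_ord_neg point v).trans (ord_jInv_neg_iff v)

/-! ### §2 `Broberg.point ∈ U_P`: `λ ∉ {0, 1}`, presented over its minimal field `ℚ(λ) = ℚ(√7)` -/

/-- `λ ∈ U`: `λ ≠ 0` and `λ ≠ 1`. [cite: MochizukiGenEll2010, Thm 2.1 (ii) p.11] -/
theorem point_inU : point.InU := by
  refine ⟨lam_ne_zero, ?_⟩
  show lam ≠ 1
  intro h
  exact lam_sub_one_ne_zero (by rw [h]; exact sub_self _)

/-- `(4 − 3√7)⁴ = 10273 − 3792√7`. [folklore] -/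
theorem den_pow_four_eq : (4 - 3 * sqrt7 : K) ^ 4 = 10273 - 3792 * sqrt7 := by
  linear_combination (81 * sqrt7 ^ 2 - 432 * sqrt7 + 1431 : K) * sqrt7_mul_sqrt7

/-- `(8 − 3√7)²(5 − 2√7) = 1307 − 494√7`. [folklore] -/
theorem num_eq : (8 - 3 * sqrt7 : K) ^ 2 * (5 - 2 * sqrt7) = 1307 - 494 * sqrt7 := by
  linear_combination (-18 * sqrt7 + 141 : K) * sqrt7_mul_sqrt7

/-- `λ·(10273 − 3792√7) = 1307 − 494√7`. [folklore] -/
theorem lam_mul_den : lam * (10273 - 3792 * sqrt7) = 1307 - 494 * sqrt7 := by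
  have hD : (4 - 3 * sqrt7 : K) ^ 4 ≠ 0 := by
    have : (4 - 3 * sqrt7 : K) = -(3 * sqrt7 - 4) := by ring
    rw [this, neg_pow]; exact mul_ne_zero (by norm_num) (pow_ne_zero 4 den_ne_zero)
  rw [← den_pow_four_eq, ← num_eq]
  unfold lam
  exact div_mul_cancel₀ _ hD

/-- **`λ ∉ ℚ`** (`λ = (1307 − 494√7)/(10273 − 3792√7)` and `1307·3792 ≠ 494·10273`). [folklore] -/
theorem lam_not_mem_bot : lam ∉ (⊥ : IntermediateField ℚ K) := by
  rw [IntermediateField.mem_bot]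
  rintro ⟨r, hr⟩
  have key := lam_mul_den
  rw [← hr] at key
  have h1 := congrArg QuadraticAlgebra.re key
  have h2 := congrArg QuadraticAlgebra.im key
  simp [sqrt7] at h1 h2
  linarith

/-- **`F_tpd = ℚ(√7)` is the minimal field of definition of `λ`: `ℚ(λ) = ℚ(√7)`** (`λ ∉ ℚ` and `[ℚ(√7) : ℚ] = 2`).
[cite: MochizukiGenEll2010, Def 1.5 (i) p.8] -/
theorem point_isMinimal : point.IsMinimal := by
  show IntermediateField.adjoin ℚ ({lam} : Set K) = ⊤
  refine IntermediateField.eq_of_le_of_finrank_le le_top ?_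
  rw [IntermediateField.finrank_top']
  -- `[ℚ(λ) : ℚ]` divides `[ℚ(√7) : ℚ] = 2` and is not `1`
  have hK : finrank ℚ K = 2 := by convert Sqrt7.finrank_eq_two
  have h1 : finrank ℚ (IntermediateField.adjoin ℚ ({lam} : Set K)) ≠ 1 := fun h =>
    lam_not_mem_bot (IntermediateField.finrank_adjoin_simple_eq_one_iff.mp h)
  have htower := Module.finrank_mul_finrank ℚ (IntermediateField.adjoin ℚ ({lam} : Set K)) K
  rw [hK] at htower
  have hle : finrank ℚ (IntermediateField.adjoin ℚ ({lam} : Set K)) ≤ 2 := Nat.le_of_dvd two_pos (Dvd.intro _ htower)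
  have hpos : 0 < finrank ℚ (IntermediateField.adjoin ℚ ({lam} : Set K)) := finrank_pos
  omega

/-- **`Broberg.point ∈ U_P`** (a point of `ℙ¹ ∖ {0,1,∞}` presented over its minimal field of definition).
[cite: MochizukiGenEll2010, Ex 1.3 (i) p.5] -/
theorem point_mem_UP : point ∈ UP := ⟨point_inU, point_isMinimal⟩

/-- `[F_tpd : ℚ] = 2` for the Broberg point. [cite: MochizukiGenEll2010, Ex 1.3 (i) p.5] -/
theorem point_degree : point.degree = 2 := by
  -- `NFPoint.degree` reads `[K : ℚ]` through the `ℚ`-algebra structure of the division ring `K`; `ℚ`-module structures on `K`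
  -- form a subsingleton, so this is `Sqrt7.finrank_eq_two`.
  have key : ∀ m : Module ℚ K, @Module.finrank ℚ K _ _ m = 2 := fun m => by
    convert Sqrt7.finrank_eq_two
    exact Subsingleton.elim _ _
  exact key _

/-! ### §3 `AdmitsCore`: `j(λ)` is none of the four core-exceptional values -/

/-- A natural number prime to `p ∈ v` is a `v`-unit: `(n) ∉ v`. [folklore] -/
theorem natCast_not_mem_of_coprime (v : HeightOneSpectrum (𝓞 K)) {p n : ℕ} (hp : (p : 𝓞 K) ∈ v.asIdeal)
    (hn : Nat.Coprime n p) : (n : 𝓞 K) ∉ v.asIdeal := by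
  intro hmem
  obtain ⟨a, b, hab⟩ := Nat.isCoprime_iff_coprime.mpr hn
  have key : (a : 𝓞 K) * (n : 𝓞 K) + (b : 𝓞 K) * (p : 𝓞 K) = 1 := by
    have := congrArg (Int.castRingHom (𝓞 K)) hab
    simpa using this
  have h1 : (1 : 𝓞 K) ∈ v.asIdeal := by
    rw [← key]
    exact v.asIdeal.add_mem (v.asIdeal.mul_mem_left _ hmem) (v.asIdeal.mul_mem_left _ hp)
  exact v.isPrime.ne_top ((Ideal.eq_top_iff_one _).mpr h1)

/-- `log v(n) = 0` for a natural number `n` prime to `p ∈ v`. [folklore] -/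
theorem log_valuation_natCast_of_coprime (v : HeightOneSpectrum (𝓞 K)) {p n : ℕ} (hp : (p : 𝓞 K) ∈ v.asIdeal)
    (hn : Nat.Coprime n p) : WithZero.log (v.valuation K (n : K)) = 0 := by
  have h := log_valuation_eq_zero_of_not_mem v (natCast_not_mem_of_coprime v hp hn)
  have h' : (((n : 𝓞 K) : 𝓞 K) : K) = (n : K) := map_natCast (algebraMap (𝓞 K) K) n
  rwa [h'] at h

/-- `3 ∈ 𝔭₃` as a cast natural number. [folklore] -/
theorem natCast_three_mem_𝔭₃ : ((3 : ℕ) : 𝓞 K) ∈ 𝔭₃.asIdeal := by exact_mod_cast three_mem_𝔭₃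

/-- `47 ∈ 𝔭₄₇` as a cast natural number. [folklore] -/
theorem natCast_fortySeven_mem_𝔭₄₇ : ((47 : ℕ) : 𝓞 K) ∈ 𝔭₄₇.asIdeal := by exact_mod_cast fortySeven_mem_𝔭₄₇

/-- `ord_{𝔭₃}(n) = 0` for `3 ∤ n`. [folklore] -/
theorem ord_𝔭₃_natCast {n : ℕ} (hn : Nat.Coprime n 3) : ord K 𝔭₃ (n : K) = 0 := by
  unfold ord; rw [log_valuation_natCast_of_coprime 𝔭₃ natCast_three_mem_𝔭₃ hn, neg_zero]

/-- `ord_{𝔭₃}(3) = 1`. [folklore] -/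
theorem ord_𝔭₃_three : ord K 𝔭₃ (3 : K) = 1 := by
  unfold ord; rw [log_valuation_three (Or.inl rfl)]; norm_num

/-- `ord_{𝔭₃}(x/y) = ord x − ord y` and `ord (x·y) = ord x + ord y` bookkeeping: `ord` of a product of non-zero elements. [folklore] -/
theorem ord_mul {x y : K} (hx : x ≠ 0) (hy : y ≠ 0) (v : HeightOneSpectrum (𝓞 K)) :
    ord K v (x * y) = ord K v x + ord K v y := by
  unfold ord
  rw [map_mul, WithZero.log_mul (valuation_ne_zero_of_ne_zero v hx) (valuation_ne_zero_of_ne_zero v hy)]; ring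

/-- `ord (x / y) = ord x − ord y` for non-zero `x, y`. [folklore] -/
theorem ord_div {x y : K} (hx : x ≠ 0) (hy : y ≠ 0) (v : HeightOneSpectrum (𝓞 K)) :
    ord K v (x / y) = ord K v x - ord K v y := by
  unfold ord
  rw [map_div₀, WithZero.log_div (valuation_ne_zero_of_ne_zero v hx) (valuation_ne_zero_of_ne_zero v hy)]; ring

/-- `ord (x ^ n) = n · ord x`. [folklore] -/
theorem ord_pow (x : K) (n : ℕ) (v : HeightOneSpectrum (𝓞 K)) : ord K v (x ^ n) = n * ord K v x := by
  unfold ord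
  rw [map_pow, WithZero.log_pow, nsmul_eq_mul]; ring

/-- `ord_{𝔭₃}` of the four core-exceptional `j`-values `2¹⁴31³/5³, 2²73³/3⁴, 1728, 0` is `≠ −2`. [folklore] -/
theorem ord_𝔭₃_ratCast_ne (q : ℚ) (hq : q ∈ coreExceptionalJ) : ord K 𝔭₃ (q : K) ≠ -2 := by
  simp only [coreExceptionalJ, Finset.mem_insert, Finset.mem_singleton] at hq
  have h2 : ord K 𝔭₃ ((2 : ℕ) : K) = 0 := ord_𝔭₃_natCast (by norm_num)
  have h5 : ord K 𝔭₃ ((5 : ℕ) : K) = 0 := ord_𝔭₃_natCast (by norm_num)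
  have h31 : ord K 𝔭₃ ((31 : ℕ) : K) = 0 := ord_𝔭₃_natCast (by norm_num)
  have h73 : ord K 𝔭₃ ((73 : ℕ) : K) = 0 := ord_𝔭₃_natCast (by norm_num)
  have n2 : ((2 : ℕ) : K) ≠ 0 := by norm_num
  have n3 : (3 : K) ≠ 0 := by norm_num
  have n5 : ((5 : ℕ) : K) ≠ 0 := by norm_num
  have n31 : ((31 : ℕ) : K) ≠ 0 := by norm_num
  have n73 : ((73 : ℕ) : K) ≠ 0 := by norm_num
  rcases hq with rfl | rfl | rfl | rfl
  · -- 488095744/125 = 2¹⁴·31³/5³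
    have hq : (((488095744 / 125 : ℚ)) : K) = ((2 : ℕ) : K) ^ 14 * ((31 : ℕ) : K) ^ 3 / ((5 : ℕ) : K) ^ 3 := by norm_num
    rw [hq, ord_div (mul_ne_zero (pow_ne_zero _ n2) (pow_ne_zero _ n31)) (pow_ne_zero _ n5),
      ord_mul (pow_ne_zero _ n2) (pow_ne_zero _ n31), ord_pow, ord_pow, ord_pow, h2, h31, h5]
    norm_num
  · -- 1556068/81 = 2²·73³/3⁴
    have hq : (((1556068 / 81 : ℚ)) : K) = ((2 : ℕ) : K) ^ 2 * ((73 : ℕ) : K) ^ 3 / (3 : K) ^ 4 := by norm_num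
    rw [hq, ord_div (mul_ne_zero (pow_ne_zero _ n2) (pow_ne_zero _ n73)) (pow_ne_zero _ n3),
      ord_mul (pow_ne_zero _ n2) (pow_ne_zero _ n73), ord_pow, ord_pow, ord_pow, h2, h73, ord_𝔭₃_three]
    norm_num
  · -- 1728 = 2⁶·3³
    have hq : (((1728 : ℚ)) : K) = ((2 : ℕ) : K) ^ 6 * (3 : K) ^ 3 := by norm_num
    rw [hq, ord_mul (pow_ne_zero _ n2) (pow_ne_zero _ n3), ord_pow, ord_pow, h2, ord_𝔭₃_three]
    norm_num
  · -- 0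
    unfold ord
    rw [Rat.cast_zero, map_zero, WithZero.log_zero]; norm_num

/-- **"The once-punctured elliptic curve `E_λ` admits an `F`-core"** in the form the proof of Cor. 2.2 (ii) uses it (p. 43): `j(λ)` is
none of `2¹⁴31³5⁻³, 2²73³3⁻⁴, 2⁶3³, 0` — indeed `ord_{𝔭₃} j(λ) = −2` while those have `ord_{𝔭₃} ∈ {0, −4, 3, 0}`.
[cite: Mochizuki2012, IUTchIV Cor. 2.2 (ii) proof p.43] -/
theorem admitsCore : Cor22.AdmitsCore point := by
  intro q hq h
  have h' : ord K 𝔭₃ (jInv lam) = ord K 𝔭₃ (q : K) := congrArg (ord K 𝔭₃) (show jInv lam = (q : K) from h)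
  rw [ord_jInv_𝔭₃] at h'
  exact ord_𝔭₃_ratCast_ne q hq h'.symm

/-! ### §4 (P2) and (P5) at the Broberg point -/

/-- A prime `l ≥ 5` divides none of the pole orders `2, 24, 8`. [folklore] -/
theorem not_dvd_pole_order {l : ℕ} (hp : l.Prime) (h5 : 5 ≤ l) {n : ℕ} (hn : n = 2 ∨ n = 24 ∨ n = 8) :
    ¬ ((l : ℤ) ∣ -(n : ℤ)) := by
  intro h
  rw [dvd_neg] at h
  have h' : l ∣ n := by exact_mod_cast h
  have h24 : l ∣ 2 ^ 3 * 3 := by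
    rcases hn with rfl | rfl | rfl
    · exact h'.trans (by norm_num)
    · exact h'.trans (by norm_num)
    · exact h'.trans (by norm_num)
  rcases (Nat.Prime.dvd_mul hp).mp h24 with h2 | h3
  · exact absurd (Nat.le_of_dvd two_pos (hp.dvd_of_dvd_pow h2)) (by omega)
  · exact absurd (Nat.le_of_dvd (by norm_num) h3) (by omega)

/-- (P2) over `ℚ(√7)`: a prime `l ≥ 5` divides no negative order of `j(λ)` — the pole orders of `j(λ)` are `2, 24, 8`
(at `𝔭₃, 𝔭₃', 𝔭₄₇`) and `j(λ)` is integral at every other place. [cite: Mochizuki2012, IUTchIV Cor. 2.2 (ii) proof (P2) p.45] -/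
theorem not_dvd_ord_jInv {l : ℕ} (hp : l.Prime) (h5 : 5 ≤ l) (v : HeightOneSpectrum (𝓞 K))
    (hv : ord K v (jInv lam) < 0) : ¬ ((l : ℤ) ∣ ord K v (jInv lam)) := by
  rcases (ord_jInv_neg_iff v).mp hv with rfl | rfl | rfl
  · rw [ord_jInv_𝔭₃]; exact not_dvd_pole_order hp h5 (n := 2) (Or.inl rfl)
  · rw [ord_jInv_𝔭₃']; exact not_dvd_pole_order hp h5 (n := 24) (Or.inr (Or.inl rfl))
  · rw [ord_jInv_𝔭₄₇]; exact not_dvd_pole_order hp h5 (n := 8) (Or.inr (Or.inr rfl))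

/-- **(P2) at the Broberg point for EVERY prime `l ≥ 5`** (`Cor22.CondP2` verbatim): "`l` does not divide any nonzero local
height `h_v`". [cite: Mochizuki2012, IUTchIV Cor. 2.2 (ii) proof (P2) p.45] -/
theorem condP2 {l : ℕ} (hp : l.Prime) (h5 : 5 ≤ l) : Cor22.CondP2 point l :=
  fun v hv => not_dvd_ord_jInv hp h5 v hv

/-- **(P5) at the Broberg point for EVERY prime `l`**: there is a bad place dividing neither `2` nor `l` — `𝔭₃` (pole order `2`)
when `l ≠ 3`, and `𝔭₄₇` (pole order `8`) when `l = 3`. [cite: Mochizuki2012, IUTchIV Cor. 2.2 (ii) proof (P5) p.46] -/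
theorem condP5 {l : ℕ} (hp : l.Prime) : Cor22.CondP5 point l := by
  by_cases hl3 : l = 3
  · subst hl3
    refine ⟨𝔭₄₇, ?_, ?_, ?_⟩
    · show ord K 𝔭₄₇ (jInv lam) < 0
      rw [ord_jInv_𝔭₄₇]; norm_num
    · exact natCast_not_mem_of_coprime 𝔭₄₇ natCast_fortySeven_mem_𝔭₄₇ (by norm_num)
    · exact natCast_not_mem_of_coprime 𝔭₄₇ natCast_fortySeven_mem_𝔭₄₇ (by norm_num)
  · refine ⟨𝔭₃, ?_, ?_, ?_⟩
    · show ord K 𝔭₃ (jInv lam) < 0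
      rw [ord_jInv_𝔭₃]; norm_num
    · exact natCast_not_mem_of_coprime 𝔭₃ natCast_three_mem_𝔭₃ (by norm_num)
    · exact natCast_not_mem_of_coprime 𝔭₃ natCast_three_mem_𝔭₃ ((Nat.coprime_primes hp Nat.prime_three).mpr hl3)

/-! ### §5 NON-VACUITY of the datum type modulo (P6) -/

/-- **`Nonempty (ThetaVolumeDatumAt Broberg.point l)` MODULO (P6)**: for every prime `l ≥ 5`, condition (P6) at the Broberg point
ALONE yields a genuine Θ-volume datum at `(Broberg.point, l)` — the route's PROVED `ThetaPartII.stub_thetaData` ([IUTchIV] Cor. 2.2 (ii)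
proof (P7)) fed with `point_mem_UP`, `admitsCore`, `condP2`, `condP5`. So the `∀ T : ThetaVolumeDatumAt Broberg.point l` theorems of
rows 9/10 are NON-VACUOUS modulo (P6), exactly as the rational rows were before the (P6) certificates.
[cite: Mochizuki2012, IUTchIV Cor. 2.2 (ii) proof (P7) p.46] -/
theorem nonempty_thetaVolumeDatumAt_of_condP6 {l : ℕ} (hp : l.Prime) (h5 : 5 ≤ l) (h6 : Cor22.CondP6 point l) :
    Nonempty (Cor22.ThetaVolumeDatumAt point l) :=
  ThetaPartII.stub_thetaData point point_mem_UP l hp h5 admitsCore (condP2 hp h5) (condP5 hp) h6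

/-- Row 9 («pilotDataOfK:broberg-Q7:7»): the datum type at `l = 7` is inhabited modulo (P6) at `l = 7`.
[cite: Mochizuki2012, IUTchIV Cor. 2.2 (ii) proof (P7) p.46] -/
theorem nonempty_thetaVolumeDatumAt_seven_of_condP6 (h6 : Cor22.CondP6 point 7) :
    Nonempty (Cor22.ThetaVolumeDatumAt point 7) :=
  nonempty_thetaVolumeDatumAt_of_condP6 (by norm_num) (by norm_num) h6

/-- Row 10 («pilotDataOfK:broberg-Q7:11»): the datum type at `l = 11` is inhabited modulo (P6) at `l = 11`.
[cite: Mochizuki2012, IUTchIV Cor. 2.2 (ii) proof (P7) p.46] -/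
theorem nonempty_thetaVolumeDatumAt_eleven_of_condP6 (h6 : Cor22.CondP6 point 11) :
    Nonempty (Cor22.ThetaVolumeDatumAt point 11) :=
  nonempty_thetaVolumeDatumAt_of_condP6 (by norm_num) (by norm_num) h6

end Summit.ABC.IUTFork.Broberg

end
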